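import Literature.AlgebraicGeometry.HilbertScheme.TransferOperatorCommutators
import Mathlib.Algebra.BigOperators.Fin
import HarnessLib

/-!
# The Heisenberg monomial basis of `H*(S^[n])` (Nakajima–Grojnowski; Li–Qin–Wang's indexing by partition-valued
functions) — definitions, bookkeeping theorems, NAMED FACT

Layer `Literature/AlgebraicGeometry/HilbertScheme`; sequel of `NakajimaOperators`.  Typed by the literature-typing seat
`hodge-lit-lqw` (cell `hodge-kum4`, lane (V)) as identification input (I1) "stub_basis" of the cell's certificate line
for `LefschetzGenerationHilb 5` (plan `alpha/cert5plan.md`): the computational model `Literature/Computation/AbelianHilbFock`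
works in the basis of an abelian surface's Fock space given by sorted monomials of creation letters `q_m(e_I)` (odd
letters at most once); this file states, on the typed interface, that such monomials ARE a basis of `H*(S^[n](ℂ); ℂ)`.

THE PRINTED STATEMENT (Li–Qin–Wang, J. reine angew. Math. 554 (2003), §6, in the conventions of Nakajima–Grojnowski):
take "a linear basis `S = S₀ ∪ S₁` of `H*(X)` such that `1_X ∈ S₀`, `S₀ ⊂ H^{even}(X)` and `S₁ ⊂ H^{odd}(X)`"; a
PARTITION-VALUED FUNCTION `ρ = (ρ(c))_{c ∈ S}` assigns to each `c` a partition `ρ(c) = (1^{m₁(c)} 2^{m₂(c)} ⋯)`, "for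
every `c ∈ S₁`, the partition `ρ(c)` is required to be strict in the sense that … `m_r(c) = 0` or `1` for all `r ≥ 1`";
`‖ρ‖ = Σ_{c, r} r·m_r(c)`, `𝒫ₙ(S) = {ρ | ‖ρ‖ = n}`; "`𝔞_{−ρ(c)}(c) = Π_{r ≥ 1} 𝔞_{−r}(c)^{m_r(c)} = 𝔞_{−1}(c)^{m₁(c)}
𝔞_{−2}(c)^{m₂(c)} ⋯`" and `Π_{c ∈ S} 𝔞_{−ρ(c)}(c) · |0⟩ ∈ H*(X^[n])`, "where we fix the order of the elements `c ∈ S₁`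
appearing in `Π_{c ∈ S}` once and for all"; then [p. 13] "As `ρ` runs over all partition-valued functions on `S` with
`‖ρ‖ ≤ n`, the corresponding `𝔞_ρ(n)` linearly span `H*(X^[n])` as a corollary to the theorem of Nakajima and Grojnowski"
and [pp. 13–14] "As an immediate consequence of the theorem of Nakajima and Grojnowski [Na2], the Heisenberg monomials
`Π_{c∈S} 𝔞_{−ρ(c)}(c) · |0⟩`, where `ρ = (ρ(c))_c ∈ 𝒫ₙ(S)`, are linearly independent in the cohomology ring `H*(X^[n])`"
(`𝔞_{−r}`, `r > 0`, is Nakajima's creation operator `𝔮_r`; LQW Math. Ann. p. 5: "a linear basis of `ℍ` is given by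
`𝔮_{i₁}(α₁) ⋯ 𝔮_{i_k}(α_k)|0⟩`, `i₁ ≥ ⋯ ≥ i_k > 0`"; Lehn Cor. 2.6: `S*W₊ ≅ ℍ`).

## Sources (read AT SOURCE this session)

* W.-P. Li, Z. Qin, W. Wang, *Stability of the cohomology rings of Hilbert schemes of points on surfaces*, J. reine angew.
  Math. 554 (2003) 217–234 (arXiv:math/0107139, "Universality and stability …") [`LiQinWang2003`; REFEREED]: §6 p. 13
  (scan `paper:arxiv-math_0107139` p0013:L7–L57: `𝒫(S)`, strictness, `‖ρ‖`, `𝔞_{−ρ(c)}(c)`, the fixed order, the span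
  statement), pp. 13–14 (p0013:L78–L82: the linear independence statement).
* W.-P. Li, Z. Qin, W. Wang, Math. Ann. 324 (2002) [`LiQinWang2002`], p. 5 (the basis sentence); H. Nakajima, Ann. of
  Math. 145 (1997) [`Nakajima1997`]; I. Grojnowski, Math. Res. Lett. 3 (1996) [`Grojnowski1996`]; M. Lehn, Invent. Math.
  136 (1999) [`Lehn1999`], Cor. 2.6 ("`S*W₊ → ℍ` is a module isomorphism").

## Rendering

* Pure algebra first (any `q : ℤ → V →ₗ End F`, any vector `vac`): `monomialOp q w = 𝔮_{r₁}(v₁) ∘ ⋯ ∘ 𝔮_{r_k}(v_k)` for a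
  word `w = [(r₁,v₁), …, (r_k,v_k)]` (written order; the LAST letter acts first); a homogeneous basis indexed by `Fin N`
  (`x : Fin N → V` with degrees `deg : Fin N → ℕ`; the linear order of `Fin N` is "the order fixed once and for all");
  `IsPartitionValued deg n ρ` for `ρ : Fin N → Fin (n+1) → ℕ` (`ρ c r = m_r(c)`, parts `1 ≤ r ≤ n` suffice when `‖ρ‖ = n`;
  `ρ c 0 = 0`; strict on odd colours; `‖ρ‖ = n`); `pvWord x n ρ` = the word `Π_{c ascending} Π_{r ascending} (r, x c)^{m_r(c)}`
  (exactly the printed order `𝔞_{−1}(c)^{m₁(c)} 𝔞_{−2}(c)^{m₂(c)} ⋯` inside each colour); `heisenbergMonomial q vac x n ρ` =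
  the vector `Π_c 𝔞_{−ρ(c)}(c)|0⟩`.
* PROVED (bookkeeping from the axioms `IsHeisenbergRepresentation`): every creation word of total mode `n` applied to the
  vacuum lies in the summand `ℍₙ` (`monomialOp_vac_mem_range`, `heisenbergMonomial_mem_range`).
* NAMED FACT `Nakajima1997_heisenbergMonomialBasis` on the tree's carriers (`NakajimaOperators hS H`, coefficients
  `H*(S(ℂ); ℂ)`, `ℍₙ = H*(S^[n](ℂ); ℂ)`): for every homogeneous basis `x` of `H*(S(ℂ); ℂ)` and every `n`, the family
  `ρ ↦ Π_c 𝔞_{−ρ(c)}(x_c)|0⟩`, `ρ ∈ 𝒫ₙ`, is linearly independent and spans `ℍₙ`.  Stated for EVERY instance of the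
  interface: for the geometric instance this is the cited theorem; for an arbitrary instance it FOLLOWS from the axioms
  (Heisenberg relations, `𝔮₋ₘ|0⟩ = 0`, cyclicity) and the non-degeneracy of `∫_S(· ∪ ·)` (Poincaré duality, in the tree)
  by Lehn's argument for Cor. 2.6 — a pure-algebra DISCHARGE path (spanning: sort creation words by the super-commutation
  `𝔮ₘ(a)𝔮_ℓ(b) = ±𝔮_ℓ(b)𝔮ₘ(a)`, `m, ℓ > 0`, and `𝔮ₘ(c)² = 0` for odd `c`; independence: induction with the annihilation
  operators as super-derivations).  Net debt +1 until then.  REFEREED.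
* HONEST FRAMING: nothing here asserts L1 / `LefschetzGenerationHilb n` / MODEL_X / HC_Kum4Type / HC.

## Not here

The graded refinement (monomials of degree `Σ (2r − 2 + |c|) m_r(c) = d` form a basis of `H^d(S^[n])` — from the
bi-degree axiom), Göttsche's count of `𝒫ₙ` (sibling `HilbertSchemeBettiNumbers`), the stable classes `𝔞_ρ(n)` with the
`1_{−(n−‖ρ‖)}` padding and LQW's stability theorem (Thm. 5.1 / 6.1).
-/

noncomputable section

open DirectSum

universe u v w

namespace Literature.AlgebraicGeometry.HilbertScheme

section Words

variable {V : Type v} {N : ℕ}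

/-- The total (creation) mode `r₁ + ⋯ + r_k` of a word. [cite: LiQinWang2003, §6 p. 13 (‖ρ‖ = Σ r·m_r(c))] -/
def wordMode (w : List (ℕ × V)) : ℕ :=
  (w.map Prod.fst).sum

/-- `wordMode` of a cons. [cite: LiQinWang2003, §6 p. 13] -/
@[simp]
theorem wordMode_cons (r : ℕ) (v : V) (w : List (ℕ × V)) : wordMode ((r, v) :: w) = r + wordMode w := by
  simp [wordMode]

/-- `wordMode` of the empty word. [cite: LiQinWang2003, §6 p. 13] -/
@[simp]
theorem wordMode_nil : wordMode ([] : List (ℕ × V)) = 0 := by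
  simp [wordMode]

/-- `wordMode` is additive under concatenation. [cite: LiQinWang2003, §6 p. 13] -/
theorem wordMode_append (w w' : List (ℕ × V)) : wordMode (w ++ w') = wordMode w + wordMode w' := by
  simp [wordMode, List.sum_append]

/-- `wordMode` of a `flatMap` is the sum of the `wordMode`s. [cite: LiQinWang2003, §6 p. 13] -/
theorem wordMode_flatMap {α : Type*} (l : List α) (f : α → List (ℕ × V)) :
    wordMode (l.flatMap f) = (l.map fun a ↦ wordMode (f a)).sum := by
  induction l with
  | nil => simp
  | cons a l ih => rw [List.flatMap_cons, wordMode_append, ih, List.map_cons, List.sum_cons]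

/-- `wordMode` of a repeated letter. [cite: LiQinWang2003, §6 p. 13] -/
theorem wordMode_replicate (k r : ℕ) (v : V) : wordMode (List.replicate k (r, v)) = k * r := by
  simp [wordMode, List.map_replicate, List.sum_replicate]

/-! ### Partition-valued functions on a homogeneous basis and their monomials -/

/-- **`ρ ∈ 𝒫ₙ(S)`: a partition-valued function of size `n` on the basis `S = {x_c}`, strict on odd colours** — `ρ c r`
is the multiplicity `m_r(c)` of the part `r` (`1 ≤ r ≤ n`; the slot `r = 0` is unused) in the partition `ρ(c)`; "for
every `c ∈ S₁`" (odd degree) "`m_r(c) = 0` or `1`"; `‖ρ‖ = Σ_{c,r} r·m_r(c) = n`.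
[cite: LiQinWang2003, §6 p. 13 (𝒫(S), 𝒫ₙ(S))] -/
def IsPartitionValued (deg : Fin N → ℕ) (n : ℕ) (ρ : Fin N → Fin (n + 1) → ℕ) : Prop :=
  (∀ c, ρ c 0 = 0) ∧ (∀ c r, Odd (deg c) → ρ c r ≤ 1) ∧ ∑ c, ∑ r : Fin (n + 1), (r : ℕ) * ρ c r = n

/-- **The word of `ρ`**: `Π_{c ∈ S} Π_{r ≥ 1} (r, x_c)^{m_r(c)}`, colours in the fixed order of `Fin N`, parts in increasing
order inside each colour ("`𝔞_{−1}(c)^{m₁(c)} 𝔞_{−2}(c)^{m₂(c)} ⋯`"; "we fix the order of the elements `c` … once and for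
all"). [cite: LiQinWang2003, §6 p. 13] -/
def pvWord (x : Fin N → V) (n : ℕ) (ρ : Fin N → Fin (n + 1) → ℕ) : List (ℕ × V) :=
  (List.finRange N).flatMap fun c ↦ (List.finRange (n + 1)).flatMap fun r ↦ List.replicate (ρ c r) ((r : ℕ), x c)

/-- The total mode of the word of `ρ` is `‖ρ‖ = Σ_{c,r} r·m_r(c)`. [cite: LiQinWang2003, §6 p. 13] -/
theorem wordMode_pvWord (x : Fin N → V) (n : ℕ) (ρ : Fin N → Fin (n + 1) → ℕ) :
    wordMode (pvWord x n ρ) = ∑ c, ∑ r : Fin (n + 1), (r : ℕ) * ρ c r := by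
  unfold pvWord
  rw [wordMode_flatMap, Fin.sum_univ_def]
  refine congrArg List.sum (List.map_congr_left fun c _ ↦ ?_)
  rw [wordMode_flatMap, Fin.sum_univ_def]
  refine congrArg List.sum (List.map_congr_left fun r _ ↦ ?_)
  rw [wordMode_replicate, mul_comm]

end Words

/-! ### Heisenberg monomials (pure algebra) -/

section Monomials

variable {K : Type u} [Field K]
variable {V : Type v} [AddCommGroup V] [Module K V] {F : Type w} [AddCommGroup F] [Module K F]

/-- **The Heisenberg monomial `𝔮_{r₁}(v₁) ∘ ⋯ ∘ 𝔮_{r_k}(v_k)` of a word** `w = [(r₁, v₁), …, (r_k, v_k)]` of (creation)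
modes `rⱼ ∈ ℕ` and coefficients `vⱼ` (written order: the last letter acts first).
[cite: LiQinWang2003, §6 p. 13 (𝔞_{−ρ(c)}(c) = Π_r 𝔞_{−r}(c)^{m_r(c)})] [cite: LiQinWang2002, p. 5 (𝔮_{i₁}(α₁)⋯𝔮_{i_k}(α_k)|0⟩)] -/
def monomialOp (q : ℤ → V →ₗ[K] Module.End K F) (w : List (ℕ × V)) : Module.End K F :=
  (w.map fun p ↦ q (p.1 : ℤ) p.2).prod

/-- The empty word is the identity. [cite: LiQinWang2002, p. 5] -/
@[simp]
theorem monomialOp_nil (q : ℤ → V →ₗ[K] Module.End K F) : monomialOp q [] = 1 := by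
  simp [monomialOp]

/-- Prepending a letter composes on the left: `𝔮_r(v) ∘ (monomial of w)`. [cite: LiQinWang2002, p. 5] -/
@[simp]
theorem monomialOp_cons (q : ℤ → V →ₗ[K] Module.End K F) (r : ℕ) (v : V) (w : List (ℕ × V)) :
    monomialOp q ((r, v) :: w) = q (r : ℤ) v * monomialOp q w := by
  simp [monomialOp]

/-- Concatenation of words is composition of monomials. [cite: LiQinWang2002, p. 5] -/
theorem monomialOp_append (q : ℤ → V →ₗ[K] Module.End K F) (w w' : List (ℕ × V)) :
    monomialOp q (w ++ w') = monomialOp q w * monomialOp q w' := by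
  simp [monomialOp, List.map_append, List.prod_append]

variable {N : ℕ}

/-- **The Heisenberg monomial vector `Π_{c ∈ S} 𝔞_{−ρ(c)}(x_c) · |0⟩`** of a partition-valued function `ρ`.
[cite: LiQinWang2003, §6 p. 13] [cite: Nakajima1997, Thm. 1.2 / §8] -/
def heisenbergMonomial (q : ℤ → V →ₗ[K] Module.End K F) (vac : F) (x : Fin N → V) (n : ℕ)
    (ρ : Fin N → Fin (n + 1) → ℕ) : F :=
  monomialOp q (pvWord x n ρ) vac

end Monomials

/-! ### Bookkeeping from the axioms: creation monomials of total mode `n` land in `ℍₙ` -/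

section Bookkeeping

variable {K : Type u} [Field K]
variable {A : ℕ → Type v} [∀ i, AddCommGroup (A i)] [∀ i, Module K (A i)]
variable {Φ : ℕ → ℕ → Type w} [∀ n i, AddCommGroup (Φ n i)] [∀ n i, Module K (Φ n i)]
variable {B : (⨁ i, A i) →ₗ[K] (⨁ i, A i) →ₗ[K] K} {q : ℤ → (⨁ i, A i) →ₗ[K] Module.End K (Fock Φ)} {vac : Fock Φ}

/-- A Heisenberg monomial maps the summand `ℍₚ` into `ℍ_{p + (total mode)}`. [cite: LiQinWang2002, Def. 2.9 (bi-degree) p. 5] -/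
theorem IsHeisenbergRepresentation.monomialOp_apply_mem_range (h : IsHeisenbergRepresentation B q vac)
    (w : List (ℕ × ⨁ i, A i)) {p : ℕ} {y : Fock Φ} (hy : y ∈ LinearMap.range (Fock.ofSummand K Φ p)) :
    monomialOp q w y ∈ LinearMap.range (Fock.ofSummand K Φ (p + wordMode w)) := by
  induction w generalizing p y with
  | nil =>
    rw [monomialOp_nil, wordMode_nil, Nat.add_zero, Module.End.one_apply]
    exact hy
  | cons l w ih =>
    obtain ⟨r, v⟩ := l
    obtain ⟨z, hz⟩ := ih hy
    rw [monomialOp_cons, Module.End.mul_apply, ← hz, wordMode_cons]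
    exact h.apply_ofSummand_mem_range (r : ℤ) v (by push_cast; ring) z

/-- **A creation monomial of total mode `n` applied to the vacuum lies in `ℍₙ = H*(S^[n])`.**
[cite: LiQinWang2002, Def. 2.5 and Def. 2.9 pp. 4–5] -/
theorem IsHeisenbergRepresentation.monomialOp_vac_mem_range (h : IsHeisenbergRepresentation B q vac)
    (w : List (ℕ × ⨁ i, A i)) : monomialOp q w vac ∈ LinearMap.range (Fock.ofSummand K Φ (wordMode w)) := by
  have hvac : vac ∈ LinearMap.range (Fock.ofSummand K Φ 0) := by
    have h0 := h.vac_mem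
    rw [show ((0 : ℤ)) = ((0 : ℕ) : ℤ) from rfl, bidegPart_natCast] at h0
    obtain ⟨x, hx⟩ := h0
    exact ⟨lof K ℕ (Φ 0) 0 x, hx⟩
  have := h.monomialOp_apply_mem_range w hvac
  rwa [Nat.zero_add] at this

/-- **The monomial `Π_c 𝔞_{−ρ(c)}(x_c)|0⟩` of `ρ ∈ 𝒫ₙ` lies in `ℍₙ`.** [cite: LiQinWang2003, §6 p. 13 (𝔞_ρ(n) ∈ H*(X^[n]))] -/
theorem IsHeisenbergRepresentation.heisenbergMonomial_mem_range (h : IsHeisenbergRepresentation B q vac) {N : ℕ}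
    (x : Fin N → ⨁ i, A i) {deg : Fin N → ℕ} {n : ℕ} {ρ : Fin N → Fin (n + 1) → ℕ}
    (hρ : IsPartitionValued deg n ρ) :
    heisenbergMonomial q vac x n ρ ∈ LinearMap.range (Fock.ofSummand K Φ n) := by
  have := h.monomialOp_vac_mem_range (pvWord x n ρ)
  rwa [wordMode_pvWord, hρ.2.2] at this

end Bookkeeping

/-! ### The named fact on the tree's carriers -/

section Geometric

open Literature.AlgebraicGeometry.Motives (SchemeOver ComplexPoints IsSmoothProjective)
open Literature.AlgebraicGeometry.Hyperkaehler (totalCohomology ofDegree)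
open Literature.AlgebraicGeometry.HodgeTheory (complexBetti)

/-- **Nakajima–Grojnowski (in Li–Qin–Wang's indexing): the Heisenberg monomials form a basis of `H*(S^[n])`.**  For a
smooth projective complex surface `S`, a choice `H` of its Hilbert schemes with Nakajima operators `𝔑`, a homogeneous
linear basis `x = (x_c)_{c ∈ Fin N}` of `H*(S(ℂ); ℂ)` (`x_c ∈ H^{deg c}`; its linear order is "the order … fixed once and
for all") and every `n`: the vectors `Π_{c} 𝔞_{−ρ(c)}(x_c)|0⟩`, `ρ ∈ 𝒫ₙ` (partition-valued functions of size `n`, strict on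
the odd `x_c`), are linearly independent and span `ℍₙ = H*(S^[n](ℂ); ℂ)` ("linearly span `H*(X^[n])` as a corollary to
the theorem of Nakajima and Grojnowski"; "are linearly independent in the cohomology ring `H*(X^[n])`").  Stated for every
instance of the interface (for an arbitrary instance it follows from the axioms and Poincaré duality of `S`: discharge
path in the module docstring).  REFEREED; net debt +1.
[cite: LiQinWang2003, §6 pp. 13–14] [cite: Nakajima1997, Thm. 1.2 / §8] [cite: Grojnowski1996, Thm. 1]
[cite: LiQinWang2002, §2 p. 5 (the basis sentence)] [cite: Lehn1999, Cor. 2.6] -/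
def Nakajima1997_heisenbergMonomialBasis : Prop :=
  ∀ ⦃S : SchemeOver ℂ⦄ (hS : IsSmoothProjective 2 S) (H : HilbertSchemesOfPoints S) (𝔑 : NakajimaOperators hS H)
    (N : ℕ) (x : Fin N → totalCohomology ℂ (ComplexPoints S)) (deg : Fin N → ℕ),
    (∀ c, x c ∈ LinearMap.range (ofDegree ℂ (ComplexPoints S) (deg c))) →
    LinearIndependent ℂ x → Submodule.span ℂ (Set.range x) = ⊤ →
    ∀ n : ℕ,
      LinearIndependent ℂ (fun ρ : {ρ : Fin N → Fin (n + 1) → ℕ // IsPartitionValued deg n ρ} ↦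
          heisenbergMonomial 𝔑.q (vacuumVector H) x n ρ.1) ∧
        Submodule.span ℂ (Set.range fun ρ : {ρ : Fin N → Fin (n + 1) → ℕ // IsPartitionValued deg n ρ} ↦
            heisenbergMonomial 𝔑.q (vacuumVector H) x n ρ.1) =
          LinearMap.range (Fock.ofSummand ℂ (fockFamily H) n)

namespace Nakajima1997_heisenbergMonomialBasis

variable {S : SchemeOver ℂ} {hS : IsSmoothProjective 2 S} {H : HilbertSchemesOfPoints S}

/-- The inclusion `span ≤ ℍₙ` needs no fact: each monomial of `ρ ∈ 𝒫ₙ` lies in `ℍₙ` by the bi-degree axiom.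
[cite: LiQinWang2003, §6 p. 13] -/
theorem span_le_range (𝔑 : NakajimaOperators hS H) {N : ℕ} (x : Fin N → totalCohomology ℂ (ComplexPoints S))
    (deg : Fin N → ℕ) (n : ℕ) :
    Submodule.span ℂ (Set.range fun ρ : {ρ : Fin N → Fin (n + 1) → ℕ // IsPartitionValued deg n ρ} ↦
        heisenbergMonomial 𝔑.q (vacuumVector H) x n ρ.1) ≤
      LinearMap.range (Fock.ofSummand ℂ (fockFamily H) n) := by
  rw [Submodule.span_le]
  rintro _ ⟨ρ, rfl⟩
  exact 𝔑.isHeisenberg.heisenbergMonomial_mem_range x ρ.2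

/-- Under the fact, `ℍₙ` has a basis indexed by `𝒫ₙ` (the monomials): packaged as a `Module.Basis` of the summand's range.
[cite: LiQinWang2003, §6 pp. 13–14] [cite: Lehn1999, Cor. 2.6] -/
theorem exists_basis (h : Nakajima1997_heisenbergMonomialBasis) (𝔑 : NakajimaOperators hS H) {N : ℕ}
    {x : Fin N → totalCohomology ℂ (ComplexPoints S)} {deg : Fin N → ℕ}
    (hdeg : ∀ c, x c ∈ LinearMap.range (ofDegree ℂ (ComplexPoints S) (deg c))) (hli : LinearIndependent ℂ x)
    (hsp : Submodule.span ℂ (Set.range x) = ⊤) (n : ℕ) :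
    ∃ b : Module.Basis {ρ : Fin N → Fin (n + 1) → ℕ // IsPartitionValued deg n ρ} ℂ
        (LinearMap.range (Fock.ofSummand ℂ (fockFamily H) n)),
      ∀ ρ, (b ρ : fockSpace H) = heisenbergMonomial 𝔑.q (vacuumVector H) x n ρ.1 := by
  obtain ⟨hind, hspan⟩ := h hS H 𝔑 N x deg hdeg hli hsp n
  refine ⟨(Module.Basis.span hind).map (LinearEquiv.ofEq _ _ hspan), fun ρ ↦ ?_⟩
  rw [Module.Basis.map_apply, LinearEquiv.coe_ofEq_apply, Module.Basis.span_apply]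

end Nakajima1997_heisenbergMonomialBasis

end Geometric

end Literature.AlgebraicGeometry.HilbertScheme

end
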